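import Summits.QuantumFields.BalabanUV.Beta.NVertexColumnK1RowTorus
import Summits.QuantumFields.BalabanUV.Beta.NVertexLamK1Prime

/-!
# `BalabanUV.Beta.FP.TowerK2bDoorReadoutPeriodised` — binder row D1, the row's ONE file (J-NOTE-19 §3, J-NOTE-20 §3 (a)∕(c)), THE S-HALF OF THE (T2) BRIDGE:
# **the torus read-out weight of (T2) is the `Mc B`-periodisation of the record's lattice column `wΦ`** —
# `perF T (AN R j) (wrapPt T (L•β), inr κ) (wrapPt T (L•z), inr ν) = Σ'_m wΦ (N := L) κ ν (β − (z + M′•m))` for every torus `T = L•M′`, `L = Lc^(j+1)`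
# (β-function cell `pub-balaban`, BINDER-OWNERS row D1 ∕ (C1) OWNER «beta-an2» gen 76, PART 47; companion of PART 46 `TowerK2bDoorReadoutColumn`)

WHY (located; v10 `FP/StepRecursionFeedNestedNamedI` STAGED, road FP g53 INTENT-3 l.68655; the row's W-2 ∕ INTENT-1 l.68663; J-NOTE-20 §3).  v10's (T2) row `hWΔT` equates the
source-wound TORUS face of the B-free lattice door family `𝒲Δ (n+1)` with a torus word whose read-out weight is
`Ŝ_a β := perF T (AN ρc (n+1)) (wrapPt T (Lc^(n+2) • β.1), inr β.2) (wrapPt T (Lc^(n+2) • a.1), inr a.2)`, `T = towerTorus Lc (fine Lc (Mc B)) (n+1)` (`T i = Lc^(n+2) · Mc B i`).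
For ONE lattice family to satisfy (T2) in EVERY box `B`, each torus factor must be the `Mc B`-periodisation of a lattice factor (J-NOTE-20 §3 (a)); for the read-out weight this
file proves it: the composite chart's multiplier–multiplier block at coarse points is the straight multiplier response `wΦ` (`NVertexLamK1Prime.AN_inr_inr_smul`), the chart is
invariant under the period lattice of every box with `Lc^(j+1) ∣ T i` (`NVertexSectorsPeriodised.AN_translate_invariant`), and `perF` is the sum over period translates of the second
argument (`KernelPeriodisationFib.perF_apply ∕ perZ_apply`); unwrapping both representatives (`translate_wrap_quo`, `NVertexColumnK1RowTorus.translate_wrap_eq`) and re-indexing the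
translate sum gives the periodised lattice column, whatever representatives `wrapPt` chose — in particular the source may be taken at the top box's own representative
`wrapPt (Mc B) y′` as (T2) spells it (§2).  With PART 46 (`Sd j ν z κ y := c_j · wΦ κ ν (y − z)` satisfies (C)(R) `hSd hSda` BY NAME) this is the S-side of the identification (X)∕(T2):
`Ŝ_{(z,ν)} (β,κ) = c_j⁻¹ · Σ'_m Sd j ν (translate (Mc B) z m) κ β`.

WHAT ([folklore] re-indexing BY NAME; no `def`, no `def … : Prop`, nothing cited, 0 sorry; `d = 3`, any `R : Roots Lc`, any door index `j`, any torus `T = Lc^(j+1) • M′`):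
§1 `wrap_eq_translate_neg_quo` (`wrap T x = translate T x (−quo T x)`), `translate_smul_eq_smul_translate` (`translate (L•M′) (L•z) m = L • translate M′ z m`),
**`perF_AN_inr_inr_eq_tsum_wΦ`** (the display above), `perF_AN_inr_inr_eq_tsum_wΦ_sub` (summand `wΦ κ ν (β − z − M′•m)`);
§2 **`perF_AN_inr_inr_wrapPt_eq_tsum_wΦ`** — the source at the top box's representative: `… (wrapPt T (L • ↑(wrapPt M′ z)), inr ν) = Σ'_m wΦ κ ν (β − translate M′ z m)` ((T2)'s literal shape),
`perF_AN_inr_inr_symm_args` (response∕source swap = `wΦ`'s reciprocity under the translate sum: `κ β ↔ ν z` with `m ↦ −m`).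
WHAT THIS IS NOT: not (T2) (the door family is NOT defined here; the `M₂ ∕ Ĉ ∕ λ` factors are untouched — STUB P, J-NOTE-20 §3 (a)); not (X); no summability claimed beyond
what `perF`'s `tsum` carries formally (the identities are re-indexings, convergence-free); nothing of Bałaban's asserted, valued or discharged; 0 estimates; 0∕4 row-D1 binders
(hW, hR, D1Tel, D1Rep); ROOT M‴ p325680 ∕ P5c ∕ D6 untouched; v10 NOT filed; v9 p617999 stands; NOT (C1), NOT (T-ID), NOT D1, NEVER «G-an2-4 closed», NOT BetaPertH, NOT continuum, NOT Clay.

HONEST DEPENDENCY (page 1, mandatory): continuum YM on T⁴ ⇐ BetaPertH ∧ nine spine estimates (0/9 proved); BetaPertH ⇐ (D1) ∧ (D4) ∧ CAP+tail;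
G-an2-4 gates asym, D1 and NE2/3/4.  HONEST FRAMING (cell contract, verbatim): «discharging `BetaPertH` makes Bałaban's UV stability UNCONDITIONAL —
a real constructive-QFT result; it is NOT the continuum limit and NOT the Clay problem.»  ABSOLUTE RULE (cell charter, verbatim): «No internally-minted
statement may enter as a cited fact. Every hypothesis is either kernel-proved in this package or a verbatim quotation of a PUBLISHED theorem with page
reference. The manuscript(s) under audit are NOT citable for their own disputed steps — they are the thing under adjudication; programme-internal
(2001/route/tribunal) claims are never citable.»  Row D1 ∕ (C1) OWNER «beta-an2» gen 76, 2026-08-28.  No existing file touched.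
-/

noncomputable section

open Finset
open scoped BigOperators
open Literature.MathematicalPhysics.QuantumFieldTheory
open Literature.MathematicalPhysics.QuantumFieldTheory.Balaban1983to89
open Literature.MathematicalPhysics.QuantumFieldTheory.Balaban1983to89.Beta
open B4TorusKernel.MultiPeriod (translate)
open B4Reflection242 (translate_translate)
open B6Lemma24Torus (pbox wrap)
open AffineAveraging (Site)
open OneStepResolventKernel (Fib)
open KernelSpecInstance (wΦ)
open Summit.QuantumFields.BalabanUV.Beta.CompositeOneShotJetData (Roots AN)
open Summit.QuantumFields.BalabanUV.Beta.NVertexSectorsPeriodised (AN_translate_invariant)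
open Summit.QuantumFields.BalabanUV.Beta.NVertexLamK1Prime (AN_inr_inr_smul)
open Summit.QuantumFields.BalabanUV.Beta.NVertexColumnK1RowTorus (translate_wrap_eq)
open Summit.QuantumFields.BalabanUV.Beta.FP.KernelPeriodisationFib (Idx perF perZ perF_apply perZ_apply)
open Summit.QuantumFields.BalabanUV.Beta.FP.TorusGaugeCovariancePairing (wrapPt wrapPt_coe)
open Summit.QuantumFields.BalabanUV.Beta.GAN24.KernelPeriodisation (quo translate_wrap_quo)
open Summit.QuantumFields.BalabanUV.Beta.GAN24.TransverseDictionary (wΦ_symm)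

namespace Summit.QuantumFields.BalabanUV.Beta.FP.TowerK2bDoorReadoutPeriodised

/-! ## §1 Unwrapping representatives; the read-out weight as the periodised lattice column -/

section Unwrap

/-- [folklore] a point is its box representative translated back: `wrap T x = translate T x (−quo T x)` (`translate_wrap_quo` rearranged). -/
theorem wrap_eq_translate_neg_quo (T : Fin (3 + 1) → ℕ) (x : Site (3 + 1)) : wrap T x = translate T x (-quo T x) := by
  have h := translate_wrap_quo T x
  funext i
  have hi := congrFun h i
  simp only [B4TorusKernel.MultiPeriod.translate_apply, Pi.neg_apply] at hi ⊢
  linarith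

/-- [folklore] translating a coarse point by the period lattice of `T = L•M′` is the coarse image of translating by `M′`: `translate T (L•z) m = L • translate M′ z m`. -/
theorem translate_smul_eq_smul_translate (L : ℕ) (T M' : Fin (3 + 1) → ℕ) (hT : ∀ i, T i = L * M' i) (z m : Site (3 + 1)) :
    translate T (((L : ℕ) : ℤ) • z) m = ((L : ℕ) : ℤ) • translate M' z m := by
  funext i
  simp only [B4TorusKernel.MultiPeriod.translate_apply, Pi.smul_apply, smul_eq_mul, hT i, Nat.cast_mul]
  ring

variable {Lc : ℕ} [NeZero Lc] (R : Roots Lc) (j : ℕ)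

/-- [folklore] **`perF_AN_inr_inr_eq_tsum_wΦ` — THE (T2) READ-OUT WEIGHT IS THE `M′`-PERIODISATION OF THE RECORD's COLUMN.**  For every torus `T` with
`T i = Lc^(j+1) · M′ i`, legs `κ ν` and coarse labels `β z`:
`perF T (AN R j) (wrapPt T (L•β), inr κ) (wrapPt T (L•z), inr ν) = Σ'_m wΦ (N := Lc^(j+1)) κ ν (β − translate M′ z m)`
(`perZ_apply`; both representatives unwrapped by `translate_wrap_quo`; `AN_translate_invariant` (`Lc^(j+1) ∣ T i`) moves the first argument's translate onto the second;
`translate_translate`; the coarse image `translate_smul_eq_smul_translate`; `AN_inr_inr_smul`; re-indexing `m ↦ m + (quo T (L•z) − quo T (L•β))` by `Equiv.tsum_eq`). -/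
theorem perF_AN_inr_inr_eq_tsum_wΦ (T M' : Fin (3 + 1) → ℕ) [∀ i, NeZero (T i)] (hT : ∀ i, T i = Lc ^ (j + 1) * M' i)
    (κ ν : Fin (3 + 1)) (β z : Site (3 + 1)) :
    perF T (AN R j) (wrapPt T (((Lc ^ (j + 1) : ℕ) : ℤ) • β), Sum.inr κ) (wrapPt T (((Lc ^ (j + 1) : ℕ) : ℤ) • z), Sum.inr ν)
      = ∑' m : Site (3 + 1), wΦ (N := Lc ^ (j + 1)) κ ν (β - translate M' z m) := by
  have hTd : ∀ i, Lc ^ (j + 1) ∣ T i := fun i => ⟨M' i, hT i⟩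
  set L : ℤ := ((Lc ^ (j + 1) : ℕ) : ℤ) with hL
  set qβ : Site (3 + 1) := quo T (L • β) with hqβ
  set qz : Site (3 + 1) := quo T (L • z) with hqz
  rw [perF_apply, perZ_apply]
  simp only [wrapPt_coe]
  -- each summand: unwrap both representatives and move the first translate onto the second argument
  have h1 : ∀ m : Site (3 + 1), AN R j (wrap T (L • β)) (translate T (wrap T (L • z)) m) (Sum.inr κ) (Sum.inr ν)
      = wΦ (N := Lc ^ (j + 1)) κ ν (β - translate M' z (m - qz + qβ)) := by
    intro m
    rw [translate_wrap_eq, wrap_eq_translate_neg_quo T (L • β), ← hqβ, ← hqz]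
    have e : translate T (L • z) (m - qz) = translate T (translate T (L • z) (m - qz + qβ)) (-qβ) := by
      rw [translate_translate]; congr 1; abel
    rw [e, AN_translate_invariant R j (M := T) hTd (-qβ) (L • β) (translate T (L • z) (m - qz + qβ)), hL,
      translate_smul_eq_smul_translate (Lc ^ (j + 1)) T M' hT z (m - qz + qβ), AN_inr_inr_smul]
  simp_rw [h1]
  exact (Equiv.addRight (-qz + qβ)).tsum_eq (fun m : Site (3 + 1) => wΦ (N := Lc ^ (j + 1)) κ ν (β - translate M' z m)) ▸ by
    refine tsum_congr fun m => ?_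
    simp only [Equiv.coe_addRight]
    congr 2
    abel

/-- [folklore] the same with the summand spelled `wΦ κ ν (β − z − M′•m)` (`translate M′ z m = z + M′•m`). -/
theorem perF_AN_inr_inr_eq_tsum_wΦ_sub (T M' : Fin (3 + 1) → ℕ) [∀ i, NeZero (T i)] (hT : ∀ i, T i = Lc ^ (j + 1) * M' i)
    (κ ν : Fin (3 + 1)) (β z : Site (3 + 1)) :
    perF T (AN R j) (wrapPt T (((Lc ^ (j + 1) : ℕ) : ℤ) • β), Sum.inr κ) (wrapPt T (((Lc ^ (j + 1) : ℕ) : ℤ) • z), Sum.inr ν)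
      = ∑' m : Site (3 + 1), wΦ (N := Lc ^ (j + 1)) κ ν (β - z - translate M' 0 m) := by
  rw [perF_AN_inr_inr_eq_tsum_wΦ R j T M' hT]
  refine tsum_congr fun m => ?_
  congr 1
  funext i
  simp only [Pi.sub_apply, B4TorusKernel.MultiPeriod.translate_apply, Pi.zero_apply]
  ring

end Unwrap

/-! ## §2 The source at the top box's own representative ((T2)'s literal shape); response∕source reciprocity under the translate sum -/

section Source

variable {Lc : ℕ} [NeZero Lc] (R : Roots Lc) (j : ℕ)

/-- [folklore] **`perF_AN_inr_inr_wrapPt_eq_tsum_wΦ` — (T2)'s READ-OUT WEIGHT, LITERALLY**: with the source taken at the top box's representative `wrapPt M′ z` (as v10's `hWΔT`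
spells `Ŝ_{(wrapPt (Mc B) y′, ν)}`), the weight is the same periodised column:
`perF T (AN R j) (wrapPt T (L•β), inr κ) (wrapPt T (L • ↑(wrapPt M′ z)), inr ν) = Σ'_m wΦ κ ν (β − translate M′ z m)` (§1 at `↑(wrapPt M′ z) = wrap M′ z`, unwrapped by
`translate_wrap_eq` and re-indexed). -/
theorem perF_AN_inr_inr_wrapPt_eq_tsum_wΦ (T M' : Fin (3 + 1) → ℕ) [∀ i, NeZero (T i)] [∀ i, NeZero (M' i)] (hT : ∀ i, T i = Lc ^ (j + 1) * M' i)
    (κ ν : Fin (3 + 1)) (β z : Site (3 + 1)) :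
    perF T (AN R j) (wrapPt T (((Lc ^ (j + 1) : ℕ) : ℤ) • β), Sum.inr κ)
        (wrapPt T (((Lc ^ (j + 1) : ℕ) : ℤ) • ((wrapPt M' z : ↥(pbox M')) : Site (3 + 1))), Sum.inr ν)
      = ∑' m : Site (3 + 1), wΦ (N := Lc ^ (j + 1)) κ ν (β - translate M' z m) := by
  rw [perF_AN_inr_inr_eq_tsum_wΦ R j T M' hT, wrapPt_coe]
  simp_rw [translate_wrap_eq M' z]
  exact (Equiv.subRight (quo M' z)).tsum_eq (fun m : Site (3 + 1) => wΦ (N := Lc ^ (j + 1)) κ ν (β - translate M' z m))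

/-- [folklore] **response∕source reciprocity under the translate sum**: swapping `(κ, β) ↔ (ν, z)` in the torus read-out weight is `wΦ`'s reciprocity
`wΦ κ ν w = wΦ ν κ (−w)` (`TransverseDictionary.wΦ_symm`) under `m ↦ −m`:
`perF T (AN R j) (wrapPt T (L•z), inr ν) (wrapPt T (L•β), inr κ) = Σ'_m wΦ κ ν (β − translate M′ z m)` as well. -/
theorem perF_AN_inr_inr_symm_args (T M' : Fin (3 + 1) → ℕ) [∀ i, NeZero (T i)] (hT : ∀ i, T i = Lc ^ (j + 1) * M' i)
    (κ ν : Fin (3 + 1)) (β z : Site (3 + 1)) :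
    perF T (AN R j) (wrapPt T (((Lc ^ (j + 1) : ℕ) : ℤ) • z), Sum.inr ν) (wrapPt T (((Lc ^ (j + 1) : ℕ) : ℤ) • β), Sum.inr κ)
      = ∑' m : Site (3 + 1), wΦ (N := Lc ^ (j + 1)) κ ν (β - translate M' z m) := by
  rw [perF_AN_inr_inr_eq_tsum_wΦ R j T M' hT ν κ z β]
  rw [← (Equiv.neg (Site (3 + 1))).tsum_eq (fun m : Site (3 + 1) => wΦ (N := Lc ^ (j + 1)) ν κ (z - translate M' β m))]
  refine tsum_congr fun m => ?_
  rw [wΦ_symm]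
  congr 1
  funext i
  simp only [Equiv.neg_apply, Pi.neg_apply, Pi.sub_apply, B4TorusKernel.MultiPeriod.translate_apply]
  ring

end Source

end Summit.QuantumFields.BalabanUV.Beta.FP.TowerK2bDoorReadoutPeriodised

end
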